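import Summits.CriticalPhenomena.PercolationContinuityZ3.Theorems.PercNearOneGluingNoHeavyLowerTailMajorityGluingQCertSound
import Summits.CriticalPhenomena.PercolationContinuityZ3.Theorems.PercNearOneGluingNoHeavyLowerTailMajorityGluingQCertSixFour
import Summits.CriticalPhenomena.PercolationContinuityZ3.Theorems.PercNearOneGluingNoHeavyLowerTailMajorityGluingEightCertLaw
import Summits.CriticalPhenomena.PercolationContinuityZ3.Theorems.PercNearOneGluingNoHeavyLowerTailMajorityGluingEightHarris
import HarnessLib

/-!
# Four of six relays cut from the hub: `μ ≤ (63/50)·max_i μ(vᵢ ↮ a₀)` by a kernel-checked certificate; `C(8), C(9) ≤ 113/50`, and `= 2` for `max ≥ 13/63` (lane prim-rate, constants-miner 1, gen 34; CANDIDATES §GEN-33 R324)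

Support file for the closed crux `NoHeavyLowerTail` (stmt-CriticalPhenomena-4575), majority-gluing line.  THE PERCOLATION DICTIONARY for the
certificate language of `…MajorityGluingQCert` at `m = 6` relays, and the theorem it buys.  For a hub `a₀`, six relays `T` (enumerated by
`t : Fin 6 → Fin n`, sorted so that the case key `x ↦ μ(t x ↔ a₀ ∧ ≥ 4 of T cut)` is monotone — the WLOG of the certificate's case chain)
and a configuration `ω`, `enc ω < 64` is the bitmask of the cut relays (`testBit_enc`); the point `lawv` is `K ↦ μ(enc = K)` (`K < 64`),
`64 ↦ δ`.  Then every `0/1`-form of the language evaluates to the probability of the corresponding event (`linv_lawv`): marginals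
`μ(t x ↮ a₀) ≤ δ`, threshold form `T = μ(4 ≤ #cut T)` (`popc` = number of cut relays), case forms `E_x = μ(t x ↔ a₀ ∧ 4 ≤ #cut)`, and a
mask that agrees with the cylinder `(A, X)` (`Cert.checkW`) evaluates to `μ(t(A) attached ∧ t(X) cut)` (`cylMem_iff`), so that every listed
row is an instance of van den Berg–Kahn's Theorem 1.2 rooted at the hub (`BergKahn.bergKahn_thm_1_2 a₀ (im A) (im B) (im X) (im Y)`, with
`im (A ||| B) = im A ∪ im B`, `im (X &&& Y) = im X ∩ im Y`, `im 0 = ∅`).  `Cert.sound` + `sixFour_check` give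
**`fourOfSix_cert` : `μ(4 ≤ #cut T) ≤ (63/50)·δ`** for every finite weighted graph (the tree had `4/3`, `fourOfSix_count`), and the generic Harris
layer of `…MajorityGluingEightHarris` turns it into **`C(8), C(9) ≤ 113/50`** (`majorityGluing_card_eight_nine_cert`), **`C(8) = C(9) = 2` whenever
`max ≥ 13/63`** (`majorityGluing_two_card_eight_nine_of_ge_cert`; tree: `1/4`) and the Harris form `δ₀ + (63/50)δ₀(1 − δ₀)`.  No sorries.
[cite: VandenbergKahn2001, Thm 1.2 (p. 123)] [cite: KozmaNitzan2024, Conj. 1 (p. 3), Conj. 4 (p. 32)]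
-/
noncomputable section

namespace Summit.CriticalPhenomena.PercolationContinuityZ3.Theorems

open MeasureTheory Set
open Literature.Probability.LatticeModels (prodBernoulli)
open Literature.Probability.Percolation
open scoped Classical

namespace HubOnly
namespace QCert

variable {n : ℕ}

/-! ### A sorted enumeration of six relays -/

/-- For `|T| = 6` and any real key `g`, an injective enumeration of `T` along which `g` is monotone. [folklore] -/
theorem exists_sorted_enum (T : Finset (Fin n)) (hT : T.card = 6) (g : Fin n → ℝ) :
    ∃ t : Fin 6 → Fin n, Function.Injective t ∧ T = Finset.univ.image t ∧ Monotone (g ∘ t) := by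
  set e := T.orderIsoOfFin hT with he
  set σ := Tuple.sort (fun i => g (e i)) with hσ
  refine ⟨fun i => (e (σ i) : Fin n), ?_, ?_, ?_⟩
  · intro i j hij
    exact σ.injective (e.injective (Subtype.val_injective hij))
  · ext v
    simp only [Finset.mem_image, Finset.mem_univ, true_and]
    constructor
    · intro hv
      refine ⟨σ.symm (e.symm ⟨v, hv⟩), ?_⟩
      simp
    · rintro ⟨i, rfl⟩
      exact (e (σ i)).2
  · exact Tuple.monotone_sort (fun i => g (e i))

/-! ### The van den Berg–Kahn rows at the law -/

/-- The trivial attached part. -/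
theorem setOf_att_empty (a₀ : Fin n) :
    {ω : BondConfig (Fin n) | ∀ a ∈ (∅ : Set (Fin n)), ω ∈ (openConn a₀ a : Set (BondConfig (Fin n)))} = univ :=
  eq_univ_of_forall fun _ _ h => absurd h (Set.notMem_empty _)

section SixRelays

variable (c : Cert) (hm : c.m = 6) (hh : c.h = 4) (hfam : c.fam = 1)
include hm

/-- **Every well-formed row holds at the law** — it is van den Berg–Kahn's Theorem 1.2 rooted at the hub for the images of its four sets.
[cite: VandenbergKahn2001, Thm 1.2 (p. 123)] -/
theorem row_lawv (w : Sym2 (Fin n) → unitInterval) (a₀ : Fin n) (t : Fin 6 → Fin n) (ht : Function.Injective t) (δ : ℝ)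
    (r : RowE) (hr : c.rowOK r = true) :
    linv 65 (fun i => Cert.bi (tb r.m1 i)) (lawv w a₀ t δ) * linv 65 (fun i => Cert.bi (tb r.m2 i)) (lawv w a₀ t δ) ≤
      linv 65 (fun i => Cert.bi (tb r.m3 i)) (lawv w a₀ t δ) * linv 65 (fun i => Cert.bi (tb r.m4 i)) (lawv w a₀ t δ) := by
  unfold Cert.rowOK at hr
  simp only [Bool.and_eq_true, decide_eq_true_eq, hm] at hr
  obtain ⟨⟨⟨⟨⟨⟨⟨_, hX⟩, _⟩, hY⟩, h1⟩, h2⟩, h3⟩, h4⟩ := hr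
  have hXY : r.X &&& r.Y < 64 := lt_of_le_of_lt Nat.and_le_left hX
  have hXuY : r.X ||| r.Y < 64 := Nat.or_lt_two_pow (n := 6) hX hY
  rw [linv_lawv _ _ _ _ _ (tb_D_of_maskOK c hm _ _ _ h1), linv_lawv _ _ _ _ _ (tb_D_of_maskOK c hm _ _ _ h2),
    linv_lawv _ _ _ _ _ (tb_D_of_maskOK c hm _ _ _ h3), linv_lawv _ _ _ _ _ (tb_D_of_maskOK c hm _ _ _ h4),
    setOf_cyl c hm a₀ t _ _ _ hX h1, setOf_cyl c hm a₀ t _ _ _ hY h2, setOf_cyl c hm a₀ t _ _ _ hXY h3,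
    setOf_cyl c hm a₀ t _ _ _ hXuY h4, im_or, im_and t ht, im_or, im_zero, setOf_att_empty, univ_inter]
  exact BergKahn.bergKahn_thm_1_2 w a₀ (im t r.A) (im t r.B) (im t r.X) (im t r.Y)

include hh hfam in
/-- **Four of six along a sorted enumeration, for ANY passing `(6,4)` certificate of case family `1`:** `cD·μ(4 ≤ #cut T) ≤ cN·δ`.
[cite: VandenbergKahn2001, Thm 1.2 (p. 123)] -/
theorem fourOfSix_of_check (hc : c.check = true) (w : Sym2 (Fin n) → unitInterval) (a₀ : Fin n) (t : Fin 6 → Fin n)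
    (ht : Function.Injective t) (T : Finset (Fin n)) (hT : T = Finset.univ.image t)
    (hmono : Monotone fun x : Fin 6 => (prodBernoulli w).real ((openConn a₀ (t x) : Set (BondConfig (Fin n))) ∩
      {ω : BondConfig (Fin n) | 4 ≤ (T.filter fun x => ω ∉ (openConn a₀ x : Set (BondConfig (Fin n)))).card}))
    (δ : ℝ) (hδ : ∀ x : Fin 6, (prodBernoulli w).real (openConn a₀ (t x) : Set (BondConfig (Fin n)))ᶜ ≤ δ) :
    (c.cD : ℝ) * (prodBernoulli w).real
        {ω : BondConfig (Fin n) | 4 ≤ (T.filter fun x => ω ∉ (openConn a₀ x : Set (BondConfig (Fin n)))).card} ≤ c.cN * δ := by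
  have hNV : c.NV = 65 := by rw [Cert.NV, hm]; rfl
  have hD : c.D = 64 := by rw [Cert.D, hm]; rfl
  have hδ0 : 0 ≤ δ := le_trans measureReal_nonneg (hδ 0)
  have hv : ∀ i, 0 ≤ lawv w a₀ t δ i := lawv_nonneg w a₀ t δ hδ0
  have hWQ : c.checkW = true ∧ c.checkQ 0 c.NV = true := by
    unfold Cert.check at hc
    simpa only [Bool.and_eq_true] using hc
  obtain ⟨_, _, _, _, hrows⟩ := c.checkW_spec hWQ.1
  have hsound := c.sound hWQ.1 hWQ.2 (lawv w a₀ t δ) hv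
    (by
      intro x hx
      rw [hm] at hx
      rw [hNV, hD, lawv_D, linv_lawv _ _ _ _ _ (margMem_D c hm x), setOf_margMem c hm a₀ t ⟨x, hx⟩]
      exact hδ ⟨x, hx⟩)
    (by
      intro x hx
      rw [hm] at hx
      rw [hNV, linv_lawv _ _ _ _ _ (eMem_D c hm hfam x), linv_lawv _ _ _ _ _ (eMem_D c hm hfam (x + 1)),
        setOf_eMem c hm hh hfam a₀ t ht T hT ⟨x, by omega⟩, setOf_eMem c hm hh hfam a₀ t ht T hT ⟨x + 1, hx⟩]
      exact hmono (Fin.mk_le_mk.2 (by omega)))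
    (by
      intro ch hch r hr
      rw [hNV]
      exact row_lawv c hm w a₀ t ht δ r (hrows ch hch r hr))
  rw [hNV, hD, lawv_D, linv_lawv _ _ _ _ _ (tMem_D c hm), setOf_tMem c hm hh a₀ t ht T hT] at hsound
  exact hsound

include hh hfam in
/-- **Four of six for ANY passing certificate, counting form** (orientation `v ↮ a₀`, `δ ≥` the six cut probabilities):
`cD·μ(4 ≤ #cut T) ≤ cN·δ`.  Future certificates with a smaller constant only need a new data file. [cite: VandenbergKahn2001, Thm 1.2 (p. 123)] -/
theorem fourOfSix_of_check_count (hc : c.check = true) (w : Sym2 (Fin n) → unitInterval) (a₀ : Fin n) (T : Finset (Fin n))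
    (hT : T.card = 6) (δ : ℝ) (hδ : ∀ v ∈ T, (prodBernoulli w).real (openConn v a₀ : Set (BondConfig (Fin n)))ᶜ ≤ δ) :
    (c.cD : ℝ) * (prodBernoulli w).real {ω : BondConfig (Fin n) | 4 ≤ (T.filter fun v => ω ∉ openConn v a₀).card} ≤ c.cN * δ := by
  have hδ' : ∀ x ∈ T, (prodBernoulli w).real (openConn a₀ x : Set (BondConfig (Fin n)))ᶜ ≤ δ := by
    intro x hx; rw [knThm2_openConn_comm]; exact hδ x hx
  have hset : {ω : BondConfig (Fin n) | 4 ≤ (T.filter fun v => ω ∉ openConn v a₀).card} =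
      {ω : BondConfig (Fin n) | 4 ≤ (T.filter (fun x => ω ∉ (openConn a₀ x : Set (BondConfig (Fin n))))).card} := by
    ext ω
    simp only [mem_setOf_eq]
    rw [Finset.filter_congr (fun v _ => by rw [knThm2_openConn_comm v a₀])]
  rw [hset]
  obtain ⟨t, ht, hTt, hmono⟩ := exists_sorted_enum T hT (fun v => (prodBernoulli w).real
    ((openConn a₀ v : Set (BondConfig (Fin n))) ∩
      {ω : BondConfig (Fin n) | 4 ≤ (T.filter fun x => ω ∉ (openConn a₀ x : Set (BondConfig (Fin n)))).card}))
  exact fourOfSix_of_check c hm hh hfam hc w a₀ t ht T hTt hmono δ fun x =>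
    hδ' (t x) (by rw [hTt]; exact Finset.mem_image_of_mem _ (Finset.mem_univ _))

end SixRelays

/-- **AT LEAST FOUR OF SIX RELAYS CUT: `μ ≤ (63/50)·δ`** (counting form over a 6-element finset, orientation `v ↮ a₀` as in `fourOfSix_count`),
for every finite weighted graph, hub `a₀`, and every `δ` bounding the six cut probabilities — by the kernel-checked degree-2 certificate
`sixFour` over the hub-rooted van den Berg–Kahn rows (the tree's previous constant was `4/3`, `fourOfSix_count`; the programme value
is the trigger constant `≈ 1.1272`). [cite: VandenbergKahn2001, Thm 1.2 (p. 123)] -/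
theorem fourOfSix_cert (w : Sym2 (Fin n) → unitInterval) (a₀ : Fin n) (T : Finset (Fin n)) (hT : T.card = 6) (δ : ℝ)
    (hδ : ∀ v ∈ T, (prodBernoulli w).real (openConn v a₀ : Set (BondConfig (Fin n)))ᶜ ≤ δ) :
    (prodBernoulli w).real {ω : BondConfig (Fin n) | 4 ≤ (T.filter fun v => ω ∉ openConn v a₀).card} ≤ 63 / 50 * δ := by
  have h := fourOfSix_of_check_count sixFour rfl rfl rfl sixFour_check w a₀ T hT δ hδ
  have hcD : (sixFour.cD : ℝ) = 50 := by norm_num [sixFour]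
  have hcN : (sixFour.cN : ℝ) = 63 := by norm_num [sixFour]
  rw [hcD, hcN] at h
  linarith

end QCert

variable {n : ℕ}

/-! ### Majority gluing at `|A| ∈ {8, 9}` with the constant `63/50` -/

/-- The cells of `|A| ∈ {8, 9}` obey the constant bound `(63/50)·δ` (`(6,4)` by `fourOfSix_cert`, `(7,5)` by `cutCount_mono`).
[cite: VandenbergKahn2001, Thm 1.2 (p. 123)] -/
theorem cell_eight_nine_cert (p : Sym2 (Fin n) → unitInterval) (A : Finset (Fin n)) (a₀ : Fin n) (h8 : 8 ≤ A.card) (h9 : A.card ≤ 9)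
    (T : Finset (Fin n)) (δ : ℝ) (haT : a₀ ∉ T) (_hTA : T ⊆ A) (hTcard : T.card + 2 = A.card) (_hδ : 0 ≤ δ)
    (hδT : ∀ v ∈ T, (prodBernoulli p).real (openConn v a₀ : Set (BondConfig (Fin n)))ᶜ ≤ δ) :
    (prodBernoulli p).real {ω : BondConfig (Fin n) | (A.card + 1) / 2 ≤ (T.filter fun v => ω ∉ openConn v a₀).card} ≤ 63 / 50 * δ :=
  cutCount_mono p a₀ 6 4 δ (63 / 50 * δ) (fun T₀ hT₀ _ hδT₀ => QCert.fourOfSix_cert p a₀ T₀ hT₀ δ hδT₀) T ((A.card + 1) / 2)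
    (by omega) (by omega) haT hδT

/-- **MAJORITY GLUING AT `|A| ∈ {8, 9}` WITH LOSS `(113/50)·max`:** for every weight function, observer `o`, hub `a₀ ∈ A`, `8 ≤ |A| ≤ 9` and
`δ₀ ≥ max_{a∈A} μ(a ↮ a₀)`: `μ(o ↔ A) − (113/50)δ₀ ≤ μ(o ↔ a₀ ∧ 2N > |A|)` (the tree had `7/3`).
[cite: VandenbergKahn2001, Thm 1.2 (p. 123)] [cite: KozmaNitzan2024, Conj. 1 (p. 3)] -/
theorem majorityGluing_card_eight_nine_cert (w : Sym2 (Fin n) → unitInterval) (A : Finset (Fin n)) (o a₀ : Fin n) (δ₀ : ℝ)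
    (ha₀ : a₀ ∈ A) (h8 : 8 ≤ A.card) (h9 : A.card ≤ 9)
    (hδ₀ : ∀ a ∈ A, (prodBernoulli w).real (openConn a a₀ : Set (BondConfig (Fin n)))ᶜ ≤ δ₀) :
    (prodBernoulli w).real (⋃ a ∈ A, openConn o a) - 113 / 50 * δ₀ ≤
      (prodBernoulli w).real {ω : BondConfig (Fin n) | ω ∈ openConn o a₀ ∧
          A.card < 2 * (A.filter fun a => ω ∈ openConn o a).card} := by
  have h := majorityGluing_of_cellConst w A o a₀ δ₀ ha₀ (by omega) (63 / 50) (by norm_num)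
    (fun p _ T δ haT hTA hTcard hδ hδT => cell_eight_nine_cert p A a₀ h8 h9 T δ haT hTA hTcard hδ hδT) hδ₀
  norm_num at h ⊢
  linarith

/-- **MAJORITY GLUING AT `|A| ∈ {8, 9}`, HARRIS FORM:** loss `δ₀ + (63/50)·δ₀·(1 − δ₀)` for `max_{a∈A} μ(a ↮ a₀) ≤ δ₀ ≤ 50/63`.
[cite: VandenbergKahn2001, Thm 1.2 (p. 123)] [cite: KozmaNitzan2024, Conj. 1 (p. 3)] -/
theorem majorityGluing_harris_card_eight_nine_cert (w : Sym2 (Fin n) → unitInterval) (A : Finset (Fin n)) (o a₀ : Fin n) (δ₀ : ℝ)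
    (ha₀ : a₀ ∈ A) (h8 : 8 ≤ A.card) (h9 : A.card ≤ 9)
    (hδ₀ : ∀ a ∈ A, (prodBernoulli w).real (openConn a a₀ : Set (BondConfig (Fin n)))ᶜ ≤ δ₀) (hδ₀' : δ₀ ≤ 50 / 63) :
    (prodBernoulli w).real (⋃ a ∈ A, openConn o a) -
        (prodBernoulli w).real {ω : BondConfig (Fin n) | ω ∈ openConn o a₀ ∧
          A.card < 2 * (A.filter fun a => ω ∈ openConn o a).card}
      ≤ δ₀ + 63 / 50 * δ₀ * (1 - δ₀) :=
  majorityGluing_harris_of_cellConst w A o a₀ δ₀ ha₀ (by omega) (63 / 50) (by norm_num)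
    (fun p _ T δ haT hTA hTcard hδ hδT => cell_eight_nine_cert p A a₀ h8 h9 T δ haT hTA hTcard hδ hδT) hδ₀ (by linarith)

/-- **`C(8) = C(9) = 2` WHENEVER `max ≥ 13/63`:** for every weight function, observer, hub `a₀ ∈ A`, `8 ≤ |A| ≤ 9` and
`δ₀ ≥ max_{a∈A} μ(a ↮ a₀)` with `δ₀ ≥ 13/63`: `μ(o ↔ A) − 2δ₀ ≤ μ(o ↔ a₀ ∧ 2N > |A|)` (the tree had the regime `max ≥ 1/4`).  The loss
`2·max` at `|A| = 8, 9` remains open only for `max < 13/63 ≈ 0.206`. [cite: VandenbergKahn2001, Thm 1.2 (p. 123)] [cite: KozmaNitzan2024, Conj. 1 (p. 3), Conj. 4 (p. 32)] -/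
theorem majorityGluing_two_card_eight_nine_of_ge_cert (w : Sym2 (Fin n) → unitInterval) (A : Finset (Fin n)) (o a₀ : Fin n)
    (δ₀ : ℝ) (ha₀ : a₀ ∈ A) (h8 : 8 ≤ A.card) (h9 : A.card ≤ 9)
    (hδ₀ : ∀ a ∈ A, (prodBernoulli w).real (openConn a a₀ : Set (BondConfig (Fin n)))ᶜ ≤ δ₀) (h1363 : 13 / 63 ≤ δ₀) :
    (prodBernoulli w).real (⋃ a ∈ A, openConn o a) - 2 * δ₀ ≤
      (prodBernoulli w).real {ω : BondConfig (Fin n) | ω ∈ openConn o a₀ ∧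
          A.card < 2 * (A.filter fun a => ω ∈ openConn o a).card} :=
  majorityGluing_two_of_cellConst w A o a₀ δ₀ ha₀ (by omega) (63 / 50) (by norm_num)
    (fun p _ T δ haT hTA hTcard hδ hδT => cell_eight_nine_cert p A a₀ h8 h9 T δ haT hTA hTcard hδ hδT) hδ₀ (by linarith)

end HubOnly

end Summit.CriticalPhenomena.PercolationContinuityZ3.Theorems

end
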